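import Literature.AnabelianGeometry.EtaleTheta.Discharge.Sec2ThetaOrbitClasses
import Literature.AnabelianGeometry.EtaleTheta.ThetaLiftUnique
import Literature.AnabelianGeometry.EtaleTheta.ContH1CoeffChange
import Mathlib.GroupTheory.OrderOfElement

/-!
# [EtTh] §1: the `Z`-translates of the étale theta class are pairwise distinct modulo torsion
# (class-level content of Prop. 1.4 (i)/(iii) + Prop. 1.5 (ii)(iii) — the input `(P14iii-cl)`)

Mochizuki, *The étale theta function …* [EtTh], Publ. RIMS **45** (2009), §1, Prop. 1.5 (ii), (iii),
PRIMS PDF p. 23 [cite: MochizukiEtTh2009, Prop 1.5 (iii) p.23]. PROOF-ONLY companion (0 definitions) of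
`ThetaCohomology.lean` by its typer (seat abc-iut-L2-t1, layer L2 of the abc-iut cell).

WHAT IS PROVED. Let `D` be a §1 theta setting, `E` étale theta data, `x ∈ O^×_K̈ · η̈^Θ ⊆ H¹(Π^tp_Ÿ, Δ_Θ)`
a theta class and `σ ∈ Π^tp_X` with image `a ∈ Z ≅ ℤ`. Prop. 1.5 (iii) (t1's named fact `Prop15iii`)
says `σ · x = x − 2a · log(Ü) − a² · log(q̈) + log(u)` on `(Π^tp_Ÿ)^Θ` (additive notation), and Prop. 1.5
(ii) (`Prop15ii`) says the Kummer classes `log(q̈)`, `log(u)` lie in `F̈² = H¹(G_K̈, Δ_Θ)`, the kernel of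
restriction to the geometric subgroup `(Δ^tp_Ÿ)^Θ`. Hence (`conj_div_eq_inflTheta`)
`σ · x − x = infl(−2a · log(Ü) + F)`, `F ∈ F̈²`, and — inflation being injective in degree one
(`inflTheta_injective`, abc-iut-L2-t12) — `σ · x − x` is a TORSION class only if a nonzero multiple
of `2a · log(Ü)` lies in `F̈²`. The printed clause "`F̈¹/F̈² = Ẑ · log(Ü)`" of Prop. 1.5 (ii) (p. 23;
recorded as "NOT typed: '`= Ẑ · log`' identifications" in `ThetaCohomology.lean`) says in particular
that `log(Ü)` has INFINITE ORDER modulo `F̈²`; with that clause as the explicit hypothesis `hL` we get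

* `not_isOfFinOrder_conj_div` — for `a ≠ 0` the class `σ · x − x` is not torsion;
* `not_isOfFinOrder_conj_zpow_div` / `…_pow_div` — for `γ ↦ a ≠ 0` and `k ≠ 0`, `γᵏ · x − x` is not
  torsion: the `Z`-translates `γᵐ · η̈^Θ`, `γⁿ · η̈^Θ` (`m ≠ n`) differ by a NON-torsion class — the
  class-level form `(P14iii-cl)` of "the zeroes [and poles] of `Θ̈`" being moved by `Z` (Prop. 1.4 (i),
  (ii): `Θ̈(q̈^a Ü) = (−1)^a q̈^{−a²} Ü^{−2a} Θ̈(Ü)` is a NON-constant multiple of `Θ̈` for `a ≠ 0`), which is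
  the residual input `hfree` (R3) of the cone node [IUTchII] Prop. 2.2 (ii) (plan/GAP-LEDGER
  G-w4d010-2; consumers `Literature.IUT.HodgeArakelov.prop22_ii'_model`, abc-iut-L2-t8's
  `hfree_of_etaDd_free`);
* the RESTRICTED forms for a subgroup `H' ≤ Π^tp_Ÿ` (e.g. `Π^tp_Ÿ̲̲ = Π^tp_Ÿ ∩ Π^tp_X̲̲` of §2):
  `res_conj_div_eq_infl` (the restriction of `σ · x − x` to `H'` is the inflation of
  `(−2a · log(Ü) + F)|_{H'^Θ}`), `not_isOfFinOrder_res_conj_div` (non-torsion as soon as `log(Ü)` has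
  infinite order on `(H' ∩ Δ^tp_X)^Θ`), and `logUdd_infiniteOrderOn_of_pow_mem` reducing the latter to
  `hL` when every `m`-th power of `(Δ^tp_Ÿ)^Θ` lies in `(H' ∩ Δ^tp_X)^Θ` (`m ≠ 0`) — on the geometric
  subgroup `(Δ^tp_Ÿ)^Θ ⊆ (Δ^tp_X)^Θ`, which CENTRALISES `Δ_Θ` (root field `ker_thetaToEll_central`),
  classes are continuous homomorphisms and the generic `ContH1.pow_eq_one_of_res_eq_one` applies.

HYPOTHESIS HYGIENE. Binders: `hC : D.Compat` (a theorem for every `D`, `Sec1CompatHolds`), the named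
§1 facts `h15 : Prop15iii E hC`, `h15ii : Prop15ii E.toKummerData hC` (FACT policy; already the
inputs of the §2 model chain `RigidOfSetting`), and `hL` = the printed, untyped clause of Prop. 1.5
(ii) quoted above, in the form `∀ n : ℤ, log(Ü)ⁿ ∈ F̈² → n = 0`. `hL` is NOT derivable over the §1
interface (`KummerData` with `logU = logUdd = 1` satisfies every typed clause), is not a new
`def … : Prop`, and is reported on plan/GAP-LEDGER (row G-L2t1-1). No `sorry`; axioms standard.
HONEST FRAMING: [EtTh] is refereed and undisputed; typed ≠ proved; nothing here takes a side on
[IUTchIII] Cor. 3.12.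
-/

noncomputable section

namespace Literature.AnabelianGeometry.EtaleTheta

open Literature.AnabelianGeometry.SemiGraphs
open scoped IsMulCommutative

/-! ## Generic: classes on a subgroup acting trivially on the coefficients -/

namespace ContH1

variable {G G' : Type*} [Group G] [TopologicalSpace G]
  [Group G'] [TopologicalSpace G'] [IsTopologicalGroup G']
  {φ : G →* G'} {A : Subgroup G'} [A.Normal] [IsMulCommutative A]

/-- If `M ≤ G` CENTRALISES the coefficients `A` (through `φ`), a continuous cocycle on `M` is a
homomorphism: `f (g h) = f g · f h`. [cite: NeukirchSchmidtWingberg2008, I §2] -/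
theorem cocycle_map_mul_of_centralizes {M : Subgroup G}
    (hcomm : ∀ g ∈ M, ∀ a : G', a ∈ A → φ g * a = a * φ g) (f : contCocycles φ A M) (g h : M) :
    f.1 (g * h) = f.1 g * f.1 h := by
  rw [f.2.2 g h]
  congr 1
  apply Subtype.ext
  rw [MulAut.conjNormal_apply, hcomm g.1 g.2 _ (f.1 h).2, mul_inv_cancel_right]

/-- Hence `f (g ^ m) = (f g) ^ m` on such an `M`. [cite: NeukirchSchmidtWingberg2008, I §2] -/
theorem cocycle_map_pow_of_centralizes {M : Subgroup G}
    (hcomm : ∀ g ∈ M, ∀ a : G', a ∈ A → φ g * a = a * φ g) (f : contCocycles φ A M) (g : M) (m : ℕ) :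
    f.1 (g ^ m) = f.1 g ^ m := by
  induction m with
  | zero => simpa using cocycle_map_one (φ := φ) (A := A) f
  | succ m ih => rw [pow_succ, cocycle_map_mul_of_centralizes hcomm, ih, pow_succ]

/-- On such an `M` every coboundary vanishes, so a class with trivial restriction to `M' ≤ M` is
represented by a cocycle VANISHING on `M'`; if moreover every `m`-th power of `M` lies in `M'`, the
class is killed by `m`. (The finite-index transfer used for `(Δ^tp_Ÿ̲̲)^Θ ⊆ (Δ^tp_Ÿ)^Θ`.)
[cite: NeukirchSchmidtWingberg2008, I §2] -/
theorem pow_eq_one_of_res_eq_one {M M' : Subgroup G} (hM'M : M' ≤ M)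
    (hcomm : ∀ g ∈ M, ∀ a : G', a ∈ A → φ g * a = a * φ g)
    {m : ℕ} (hpow : ∀ g ∈ M, g ^ m ∈ M') (z : ContH1 φ A M) (hz : res φ A hM'M z = 1) :
    z ^ m = 1 := by
  induction z using QuotientGroup.induction_on with
  | H f =>
    -- the restricted cocycle is a coboundary, hence vanishes on `M'`
    have hres : (QuotientGroup.mk (resCocycle φ A hM'M f) :
        contCocycles φ A M' ⧸ (contCoboundaries φ A M').subgroupOf (contCocycles φ A M')) = 1 := hz
    rw [QuotientGroup.eq_one_iff, Subgroup.mem_subgroupOf] at hres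
    obtain ⟨a, ha⟩ := (mem_contCoboundaries_iff _).mp hres
    have hvan : ∀ k : M', f.1 ⟨k.1, hM'M k.2⟩ = 1 := fun k => by
      have hk := congrFun ha k
      have hk' : (resCocycle φ A hM'M f).1 k = f.1 ⟨k.1, hM'M k.2⟩ := rfl
      rw [← hk', hk]
      apply Subtype.ext
      rw [Subgroup.coe_mul, Subgroup.coe_inv, MulAut.conjNormal_apply,
        hcomm k.1 (hM'M k.2) _ a.2, mul_inv_cancel_right, mul_inv_cancel, Subgroup.coe_one]
    -- `f ^ m` vanishes identically
    have hfm : f ^ m = 1 := by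
      apply Subtype.ext
      funext g
      have h1 : (f ^ m).1 g = f.1 g ^ m := by
        simp only [SubmonoidClass.coe_pow, Pi.pow_apply]
      rw [h1, ← cocycle_map_pow_of_centralizes hcomm f g m]
      exact hvan ⟨(g ^ m).1, hpow g.1 g.2⟩
    change (QuotientGroup.mk f : contCocycles φ A M ⧸
        (contCoboundaries φ A M).subgroupOf (contCocycles φ A M)) ^ m = 1
    rw [← QuotientGroup.mk_pow, hfm, QuotientGroup.mk_one]

section Comap

variable {G₀ : Type*} [Group G₀] [TopologicalSpace G₀] {ι : G₀ →* G} {hι : Continuous ι}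

/-- A class whose PULL-BACK along `ι : G₀ → G` to `H₀` (`ContH1.comap`, abc-iut-w4-d014) is trivial has
trivial RESTRICTION to the image subgroup `ι(H₀) ≤ H` (every element of `ι(H₀)` is some `ι k`, and the
coboundary witnessing triviality on `H₀` serves on `ι(H₀)`). [cite: NeukirchSchmidtWingberg2008, I §5] -/
theorem res_eq_one_of_comap_eq_one {H₀ : Subgroup G₀} {H : Subgroup G} (h : H₀.map ι ≤ H)
    (x : ContH1 φ A H) (hx : ContH1.comap φ A ι hι h x = 1) : res φ A h x = 1 := by
  induction x using QuotientGroup.induction_on with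
  | H f =>
    have hx' : (QuotientGroup.mk (ContH1.comapCocycle φ A ι hι h f) :
        contCocycles (φ.comp ι) A H₀ ⧸
          (contCoboundaries (φ.comp ι) A H₀).subgroupOf (contCocycles (φ.comp ι) A H₀)) = 1 := hx
    rw [QuotientGroup.eq_one_iff, Subgroup.mem_subgroupOf] at hx'
    obtain ⟨a, ha⟩ := (mem_contCoboundaries_iff _).mp hx'
    change (QuotientGroup.mk (resCocycle φ A h f) :
        contCocycles φ A (H₀.map ι) ⧸
          (contCoboundaries φ A (H₀.map ι)).subgroupOf (contCocycles φ A (H₀.map ι))) = 1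
    rw [QuotientGroup.eq_one_iff, Subgroup.mem_subgroupOf]
    refine (mem_contCoboundaries_iff _).mpr ⟨a, ?_⟩
    funext y
    obtain ⟨k, hk, hky⟩ := Subgroup.mem_map.1 y.2
    have hk' := congrFun ha ⟨k, hk⟩
    have hy : y = ⟨ι k, ⟨k, hk, rfl⟩⟩ := Subtype.ext hky.symm
    subst hy
    simpa [ContH1.comapCocycle, resCocycle] using hk'

/-- Hence a class whose pull-back to `H₀` is TORSION has torsion restriction to `ι(H₀)`.
[cite: NeukirchSchmidtWingberg2008, I §5] -/
theorem isOfFinOrder_res_of_isOfFinOrder_comap {H₀ : Subgroup G₀} {H : Subgroup G} (h : H₀.map ι ≤ H)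
    (x : ContH1 φ A H) (hx : IsOfFinOrder (ContH1.comap φ A ι hι h x)) :
    IsOfFinOrder (res φ A h x) := by
  obtain ⟨N, hN, hpow⟩ := isOfFinOrder_iff_pow_eq_one.mp hx
  refine isOfFinOrder_iff_pow_eq_one.mpr ⟨N, hN, ?_⟩
  rw [← map_pow] at hpow ⊢
  exact res_eq_one_of_comap_eq_one h _ hpow

end Comap

end ContH1

/-! ## The §1 classes -/

namespace ThetaSetting

variable {p : ℕ} [Fact p.Prime] {D : ThetaSetting p}

/-- `(Δ^tp_Ÿ)^Θ = ` the image of `Δ^tp_Ÿ = Π^tp_Ÿ ∩ Δ^tp_X` centralises `Δ_Θ`: "`Δ^Θ_X`" is a central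
extension (root field `ker_thetaToEll_central`, p. 12) and `(Δ^tp_Ÿ)^Θ ⊆ (Δ^tp_X)^Θ`.
[cite: MochizukiEtTh2009, §1 p.12] -/
theorem deltaTheta_comm_of_mem_map_deltaTemp {H : Subgroup D.PiTemp} (hH : H ≤ D.DeltaTemp)
    (g : D.GtpTheta) (hg : g ∈ H.map D.toTheta) (a : D.GtpTheta) (ha : a ∈ D.DeltaTheta) :
    MonoidHom.id D.GtpTheta g * a = a * MonoidHom.id D.GtpTheta g := by
  rw [MonoidHom.id_apply]
  exact (D.ker_thetaToEll_central a ha g (Subgroup.map_mono hH hg)).symm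

namespace EtaleThetaData

variable (E : D.EtaleThetaData)

/-- **The structure of `σ · x − x`** for a theta class `x ∈ O^×_K̈ · η̈^Θ` and `σ ∈ Π^tp_X ↦ a ∈ Z`
(Prop. 1.5 (iii) + (ii), class level, multiplicative notation): `σ · x · x⁻¹` is the inflation from
`(Π^tp_Ÿ)^Θ` of `log(Ü)^{−2a} · F` with `F ∈ F̈²` (`F = log(q̈)^{−a²} · log(u)`).
[cite: MochizukiEtTh2009, Prop 1.5 (iii) p.23] -/
theorem conj_div_eq_inflTheta (hC : D.Compat) (h15 : Prop15iii E hC)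
    (h15ii : Prop15ii E.toKummerData hC) {x : D.H1 D.GtpYdd} (hx : x ∈ E.thetaClasses)
    (σ : D.PiTemp) :
    ∃ F ∈ (Fdd2 : Subgroup (D.H1Theta (D.GtpYdd.map D.toTheta))),
      haveI := hC.GtpYdd_normal
      ContH1.conj D.toTheta D.DeltaTheta σ x * x⁻¹ =
        D.inflTheta D.GtpYdd (E.logUdd ^ (-(2 * Multiplicative.toAdd (D.toZ σ))) * F) := by
  haveI := hC.GtpYdd_normal
  haveI := hC.GtpYddTheta_normal
  obtain ⟨x', ⟨hx', -, hΦ⟩, -⟩ := h15 x hx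
  obtain ⟨u, -, hu⟩ := hΦ σ
  set a : ℤ := Multiplicative.toAdd (D.toZ σ) with ha
  refine ⟨E.kumYdd (E.toKddHat D.qddUnit) ^ (-(a * a)) * E.kumYdd (E.toKddHat u), ?_, ?_⟩
  · have hmem : ∀ v : (↥D.Kdd)ˣ, E.kumYdd (E.toKddHat v) ∈
        (Fdd2 : Subgroup (D.H1Theta (D.GtpYdd.map D.toTheta))) := fun v => by
      rw [h15ii.Fdd2_eq]; exact ⟨_, rfl⟩
    exact mul_mem (zpow_mem (hmem _) _) (hmem u)
  · have e1 : ContH1.conj D.toTheta D.DeltaTheta σ x =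
        D.inflTheta D.GtpYdd (ContH1.conj (MonoidHom.id D.GtpTheta) D.DeltaTheta (D.toTheta σ) x') := by
      rw [← hx']
      exact (ContH1.infl_conj (H₀ := D.GtpYdd) (H' := D.GtpYdd.map D.toTheta)
        (hψ := D.continuous_toTheta) le_rfl σ x').symm
    rw [e1, hu, ← hx', ← map_inv (D.inflTheta D.GtpYdd), ← map_mul (D.inflTheta D.GtpYdd)]
    congr 1
    apply (Additive.ofMul : D.H1Theta (D.GtpYdd.map D.toTheta) ≃ _).injective
    simp only [ofMul_mul, ofMul_inv, ofMul_zpow]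
    module

/-- In a commutative group: if `(L ^ c * F) ^ N = 1` then `L ^ (c * N) = (F ^ N)⁻¹`. [folklore] -/
private theorem zpow_mul_eq_inv_of_pow_eq_one {Γ : Type*} [CommGroup Γ] {L F : Γ} {c : ℤ} {N : ℕ}
    (h : (L ^ c * F) ^ N = 1) : L ^ (c * N) = (F ^ N)⁻¹ := by
  rw [mul_pow, ← zpow_natCast (L ^ c), ← zpow_mul] at h
  exact eq_inv_of_mul_eq_one_left h

/-- `a = 0` from `−(2a) · N = 0` with `N > 0`. [folklore] -/
private theorem toZ_eq_one_of {σ : D.PiTemp} {N : ℕ} (hN : 0 < N)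
    (h : -(2 * Multiplicative.toAdd (D.toZ σ)) * (N : ℤ) = 0) : D.toZ σ = 1 := by
  have hN' : (N : ℤ) ≠ 0 := by exact_mod_cast hN.ne'
  have ha : Multiplicative.toAdd (D.toZ σ) = 0 := by
    rcases mul_eq_zero.mp h with h2 | h2
    · omega
    · exact absurd h2 hN'
  rw [← ofAdd_toAdd (D.toZ σ), ha, ofAdd_zero]

/-- **`σ · x − x` is not a torsion class for `σ ↦ a ≠ 0`** (`x` a theta class), GIVEN the printed clause
"`F̈¹/F̈² = Ẑ · log(Ü)`" of Prop. 1.5 (ii) in the form `hL`: `log(Ü)` has infinite order modulo `F̈²`.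
Proof: `σ·x·x⁻¹ = infl(log(Ü)^{−2a} · F)`; inflation is injective (`inflTheta_injective`); an `N`-th
power being trivial forces `log(Ü)^{−2aN} ∈ F̈²`, so `a = 0`. [cite: MochizukiEtTh2009, Prop 1.5 (ii) p.23] -/
theorem not_isOfFinOrder_conj_div (hC : D.Compat) (h15 : Prop15iii E hC)
    (h15ii : Prop15ii E.toKummerData hC)
    (hL : ∀ n : ℤ, E.logUdd ^ n ∈ (Fdd2 : Subgroup (D.H1Theta (D.GtpYdd.map D.toTheta))) → n = 0)
    {σ : D.PiTemp} (hσ : D.toZ σ ≠ 1) {x : D.H1 D.GtpYdd} (hx : x ∈ E.thetaClasses) :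
    haveI := hC.GtpYdd_normal
    ¬ IsOfFinOrder (ContH1.conj D.toTheta D.DeltaTheta σ x * x⁻¹) := by
  haveI := hC.GtpYdd_normal
  obtain ⟨F, hF, heq⟩ := E.conj_div_eq_inflTheta hC h15 h15ii hx σ
  intro hfin
  obtain ⟨N, hN, hpow⟩ := isOfFinOrder_iff_pow_eq_one.mp hfin
  rw [heq, ← map_pow] at hpow
  have h1 : (E.logUdd ^ (-(2 * Multiplicative.toAdd (D.toZ σ))) * F) ^ N = 1 :=
    D.inflTheta_injective D.GtpYdd (by rw [hpow, map_one])
  have h2 := zpow_mul_eq_inv_of_pow_eq_one h1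
  have hmem : E.logUdd ^ (-(2 * Multiplicative.toAdd (D.toZ σ)) * (N : ℤ)) ∈
      (Fdd2 : Subgroup (D.H1Theta (D.GtpYdd.map D.toTheta))) := by
    rw [h2]; exact inv_mem (pow_mem hF N)
  exact hσ (toZ_eq_one_of hN (hL _ hmem))

/-- `γ ↦ a ≠ 0` and `k ≠ 0` give `γᵏ ↦ k a ≠ 0` in `Z ≅ ℤ`. [folklore] -/
private theorem toZ_zpow_ne_one {γ : D.PiTemp} (hγ : D.toZ γ ≠ 1) {k : ℤ} (hk : k ≠ 0) :
    D.toZ (γ ^ k) ≠ 1 := by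
  intro h
  rw [map_zpow] at h
  have h' : k * Multiplicative.toAdd (D.toZ γ) = 0 := by
    have := congrArg Multiplicative.toAdd h
    simpa [toAdd_zpow, mul_comm] using this
  rcases mul_eq_zero.mp h' with h1 | h1
  · exact hk h1
  · exact hγ (by rw [← ofAdd_toAdd (D.toZ γ), h1, ofAdd_zero])

/-- **`(P14iii-cl)`, the `Z`-translates of a theta class are pairwise distinct modulo torsion**: for
`γ ∈ Π^tp_X` with nonzero image in `Z` (e.g. a generator of `Π^tp_X/Π^tp_Y ≅ Z`) and `k ≠ 0`, the class
`γᵏ · x · x⁻¹ ∈ H¹(Π^tp_Ÿ, Δ_Θ)` is not torsion (`x ∈ O^×_K̈ · η̈^Θ`); equivalently `γᵐ · x` and `γⁿ · x`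
differ by a non-torsion class for `m ≠ n`. Given `hL` as above. [cite: MochizukiEtTh2009, Prop 1.5 (iii) p.23] -/
theorem not_isOfFinOrder_conj_zpow_div (hC : D.Compat) (h15 : Prop15iii E hC)
    (h15ii : Prop15ii E.toKummerData hC)
    (hL : ∀ n : ℤ, E.logUdd ^ n ∈ (Fdd2 : Subgroup (D.H1Theta (D.GtpYdd.map D.toTheta))) → n = 0)
    {γ : D.PiTemp} (hγ : D.toZ γ ≠ 1) {k : ℤ} (hk : k ≠ 0) {x : D.H1 D.GtpYdd}
    (hx : x ∈ E.thetaClasses) :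
    haveI := hC.GtpYdd_normal
    ¬ IsOfFinOrder (ContH1.conj D.toTheta D.DeltaTheta (γ ^ k) x * x⁻¹) :=
  E.not_isOfFinOrder_conj_div hC h15 h15ii hL (toZ_zpow_ne_one hγ hk) hx

/-- The same with a natural-number exponent `k ≠ 0`. [cite: MochizukiEtTh2009, Prop 1.5 (iii) p.23] -/
theorem not_isOfFinOrder_conj_pow_div (hC : D.Compat) (h15 : Prop15iii E hC)
    (h15ii : Prop15ii E.toKummerData hC)
    (hL : ∀ n : ℤ, E.logUdd ^ n ∈ (Fdd2 : Subgroup (D.H1Theta (D.GtpYdd.map D.toTheta))) → n = 0)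
    {γ : D.PiTemp} (hγ : D.toZ γ ≠ 1) {k : ℕ} (hk : k ≠ 0) {x : D.H1 D.GtpYdd}
    (hx : x ∈ E.thetaClasses) :
    haveI := hC.GtpYdd_normal
    ¬ IsOfFinOrder (ContH1.conj D.toTheta D.DeltaTheta (γ ^ k) x * x⁻¹) := by
  have h := E.not_isOfFinOrder_conj_zpow_div hC h15 h15ii hL hγ (k := (k : ℤ))
    (by exact_mod_cast hk) hx
  rwa [zpow_natCast] at h

/-- The two translates themselves: for `m ≠ n`, `γᵐ · x · (γⁿ · x)⁻¹` is not torsion (it is the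
`γⁿ`-conjugate of `γ^{m−n} · x · x⁻¹`, and `conj` is a group automorphism).
[cite: MochizukiEtTh2009, Prop 1.5 (iii) p.23] -/
theorem not_isOfFinOrder_conj_zpow_div_conj_zpow (hC : D.Compat) (h15 : Prop15iii E hC)
    (h15ii : Prop15ii E.toKummerData hC)
    (hL : ∀ n : ℤ, E.logUdd ^ n ∈ (Fdd2 : Subgroup (D.H1Theta (D.GtpYdd.map D.toTheta))) → n = 0)
    {γ : D.PiTemp} (hγ : D.toZ γ ≠ 1) {m n : ℤ} (hmn : m ≠ n) {x : D.H1 D.GtpYdd}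
    (hx : x ∈ E.thetaClasses) :
    haveI := hC.GtpYdd_normal
    ¬ IsOfFinOrder (ContH1.conj D.toTheta D.DeltaTheta (γ ^ m) x *
      (ContH1.conj D.toTheta D.DeltaTheta (γ ^ n) x)⁻¹) := by
  haveI := hC.GtpYdd_normal
  have hkey := E.not_isOfFinOrder_conj_zpow_div hC h15 h15ii hL hγ (sub_ne_zero.mpr hmn) hx
  intro hfin
  apply hkey
  -- `γᵐ·x·(γⁿ·x)⁻¹ = γⁿ · (γ^{m-n}·x·x⁻¹)`
  have heq : ContH1.conj D.toTheta D.DeltaTheta (γ ^ m) x *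
      (ContH1.conj D.toTheta D.DeltaTheta (γ ^ n) x)⁻¹ =
      ContH1.conj D.toTheta D.DeltaTheta (γ ^ n)
        (ContH1.conj D.toTheta D.DeltaTheta (γ ^ (m - n)) x * x⁻¹) := by
    rw [map_mul, map_inv, ← ContH1.conj_mul_apply, ← zpow_add, add_sub_cancel]
  rw [heq] at hfin
  obtain ⟨N, hN, hpow⟩ := isOfFinOrder_iff_pow_eq_one.mp hfin
  refine isOfFinOrder_iff_pow_eq_one.mpr ⟨N, hN, ?_⟩
  rw [← map_pow] at hpow
  have := congrArg (ContH1.conj D.toTheta D.DeltaTheta (γ ^ n)⁻¹) hpow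
  rwa [ContH1.conj_inv_conj_apply, map_one] at this

/-! ### Restricted forms (for `Π^tp_Ÿ̲̲ ⊆ Π^tp_Ÿ` and other subgroups) -/

/-- **The restriction of `σ · x − x` to a subgroup `H' ≤ Π^tp_Ÿ`** is the inflation from `H'^Θ` (the
image of `H'` in `(Π^tp_X)^Θ`) of the restriction of `log(Ü)^{−2a} · F`, `F ∈ F̈²`.
[cite: MochizukiEtTh2009, Prop 1.5 (iii) p.23] -/
theorem res_conj_div_eq_infl (hC : D.Compat) (h15 : Prop15iii E hC)
    (h15ii : Prop15ii E.toKummerData hC) {x : D.H1 D.GtpYdd} (hx : x ∈ E.thetaClasses)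
    (σ : D.PiTemp) {H' : Subgroup D.PiTemp} (hH' : H' ≤ D.GtpYdd) :
    ∃ F ∈ (Fdd2 : Subgroup (D.H1Theta (D.GtpYdd.map D.toTheta))),
      haveI := hC.GtpYdd_normal
      ContH1.res D.toTheta D.DeltaTheta hH' (ContH1.conj D.toTheta D.DeltaTheta σ x * x⁻¹) =
        D.inflTheta H' (ContH1.res (MonoidHom.id D.GtpTheta) D.DeltaTheta (Subgroup.map_mono hH')
          (E.logUdd ^ (-(2 * Multiplicative.toAdd (D.toZ σ))) * F)) := by
  haveI := hC.GtpYdd_normal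
  obtain ⟨F, hF, heq⟩ := E.conj_div_eq_inflTheta hC h15 h15ii hx σ
  refine ⟨F, hF, ?_⟩
  rw [heq]
  exact ContH1.infl_res (H₀ := H') (H₁ := D.GtpYdd) (H' := H'.map D.toTheta)
    (H'' := D.GtpYdd.map D.toTheta) (hψ := D.continuous_toTheta) hH' (Subgroup.map_mono hH')
    le_rfl le_rfl _

/-- `(H' ∩ Δ^tp_X)^Θ ≤ H'^Θ` (images in the theta quotient, p. 12). [cite: MochizukiEtTh2009, §1 p.12] -/
theorem map_inf_deltaTemp_le (H' : Subgroup D.PiTemp) :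
    (H' ⊓ D.DeltaTemp).map D.toTheta ≤ H'.map D.toTheta :=
  Subgroup.map_mono inf_le_left

/-- `(H' ∩ Δ^tp_X)^Θ ≤ (Δ^tp_Ÿ)^Θ` for `H' ≤ Π^tp_Ÿ` (`Δ^tp_Ÿ = Π^tp_Ÿ ∩ Δ^tp_X`, p. 20).
[cite: MochizukiEtTh2009, Prop 1.5 (ii) p.23] -/
theorem map_inf_deltaTemp_le_DtpYddTheta {H' : Subgroup D.PiTemp} (hH' : H' ≤ D.GtpYdd) :
    (H' ⊓ D.DeltaTemp).map D.toTheta ≤ (D.DtpYddN 1).map D.toTheta :=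
  Subgroup.map_mono (inf_le_inf_right D.DeltaTemp hH')

/-- Classes of `F̈²` die on `(H' ∩ Δ^tp_X)^Θ ⊆ (Δ^tp_Ÿ)^Θ` (`F̈²` is the kernel of restriction to
`(Δ^tp_Ÿ)^Θ`). [cite: MochizukiEtTh2009, Prop 1.5 (ii) p.23] -/
theorem res_eq_one_of_mem_Fdd2 {H' : Subgroup D.PiTemp} (hH' : H' ≤ D.GtpYdd)
    {F : D.H1Theta (D.GtpYdd.map D.toTheta)}
    (hF : F ∈ (Fdd2 : Subgroup (D.H1Theta (D.GtpYdd.map D.toTheta)))) :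
    ContH1.res (MonoidHom.id D.GtpTheta) D.DeltaTheta
      ((map_inf_deltaTemp_le_DtpYddTheta hH').trans
        (Subgroup.map_mono inf_le_left : (D.DtpYddN 1).map D.toTheta ≤ D.GtpYdd.map D.toTheta)) F = 1 := by
  have hF' : ContH1.res (MonoidHom.id D.GtpTheta) D.DeltaTheta
      (Subgroup.map_mono inf_le_left : (D.DtpYddN 1).map D.toTheta ≤ D.GtpYdd.map D.toTheta) F = 1 := hF
  rw [← ContH1.res_res (φ := MonoidHom.id D.GtpTheta) (A := D.DeltaTheta)
    (map_inf_deltaTemp_le_DtpYddTheta hH')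
    (Subgroup.map_mono inf_le_left : (D.DtpYddN 1).map D.toTheta ≤ D.GtpYdd.map D.toTheta), hF', map_one]

/-- **Non-torsion of the restricted class.** For `H' ≤ Π^tp_Ÿ`, `σ ↦ a ≠ 0` and a theta class `x`, the
restriction of `σ · x − x` to `H'` is not torsion PROVIDED `log(Ü)` has infinite order on the geometric
part `(H' ∩ Δ^tp_X)^Θ` (hypothesis `hLH'`; see `logUdd_infiniteOrderOn_of_pow_mem` for its reduction to
`hL`). [cite: MochizukiEtTh2009, Prop 1.5 (iii) p.23] -/
theorem not_isOfFinOrder_res_conj_div (hC : D.Compat) (h15 : Prop15iii E hC)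
    (h15ii : Prop15ii E.toKummerData hC) {H' : Subgroup D.PiTemp} (hH' : H' ≤ D.GtpYdd)
    (hLH' : ∀ n : ℤ, ContH1.res (MonoidHom.id D.GtpTheta) D.DeltaTheta
        ((map_inf_deltaTemp_le_DtpYddTheta hH').trans
          (Subgroup.map_mono inf_le_left : (D.DtpYddN 1).map D.toTheta ≤ D.GtpYdd.map D.toTheta))
        (E.logUdd ^ n) = 1 → n = 0)
    {σ : D.PiTemp} (hσ : D.toZ σ ≠ 1) {x : D.H1 D.GtpYdd} (hx : x ∈ E.thetaClasses) :
    haveI := hC.GtpYdd_normal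
    ¬ IsOfFinOrder
      (ContH1.res D.toTheta D.DeltaTheta hH' (ContH1.conj D.toTheta D.DeltaTheta σ x * x⁻¹)) := by
  haveI := hC.GtpYdd_normal
  obtain ⟨F, hF, heq⟩ := E.res_conj_div_eq_infl hC h15 h15ii hx σ hH'
  intro hfin
  obtain ⟨N, hN, hpow⟩ := isOfFinOrder_iff_pow_eq_one.mp hfin
  rw [heq, ← map_pow] at hpow
  -- inflation from `H'^Θ` to `H'` is injective
  have h1 : (ContH1.res (MonoidHom.id D.GtpTheta) D.DeltaTheta (Subgroup.map_mono hH')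
      (E.logUdd ^ (-(2 * Multiplicative.toAdd (D.toZ σ))) * F)) ^ N = 1 :=
    D.inflTheta_injective H' (by rw [hpow, map_one])
  rw [map_mul, map_zpow] at h1
  have h2 := zpow_mul_eq_inv_of_pow_eq_one h1
  -- restrict further to the geometric part `(H' ∩ Δ^tp_X)^Θ`, where `F` dies
  set hle := (map_inf_deltaTemp_le_DtpYddTheta hH').trans
    (Subgroup.map_mono inf_le_left : (D.DtpYddN 1).map D.toTheta ≤ D.GtpYdd.map D.toTheta) with hle_def
  have hsplit : ContH1.res (MonoidHom.id D.GtpTheta) D.DeltaTheta hle =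
      (ContH1.res (MonoidHom.id D.GtpTheta) D.DeltaTheta (map_inf_deltaTemp_le H')).comp
        (ContH1.res (MonoidHom.id D.GtpTheta) D.DeltaTheta (Subgroup.map_mono hH')) := by
    ext z
    exact (ContH1.res_res (φ := MonoidHom.id D.GtpTheta) (A := D.DeltaTheta)
      (map_inf_deltaTemp_le H') (Subgroup.map_mono hH') z).symm
  have hF1 : ContH1.res (MonoidHom.id D.GtpTheta) D.DeltaTheta hle F = 1 :=
    res_eq_one_of_mem_Fdd2 hH' hF
  have h3 : ContH1.res (MonoidHom.id D.GtpTheta) D.DeltaTheta hle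
      (E.logUdd ^ (-(2 * Multiplicative.toAdd (D.toZ σ)) * (N : ℤ))) = 1 := by
    rw [hsplit, MonoidHom.comp_apply, map_zpow, h2, map_inv, map_pow, ← MonoidHom.comp_apply,
      ← hsplit, hF1, one_pow, inv_one]
  exact hσ (toZ_eq_one_of hN (hLH' _ h3))

/-- **Reduction of `hLH'` to `hL`.** If every `m`-th power (`m ≠ 0`) of `(Δ^tp_Ÿ)^Θ` lies in
`(H' ∩ Δ^tp_X)^Θ` (e.g. `H' = Π^tp_Ÿ̲̲`, `m = l`, `(Δ^tp_Y)^Θ` being abelian), then `log(Ü)` has infinite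
order on `(H' ∩ Δ^tp_X)^Θ` as soon as it has infinite order modulo `F̈²`: on `(Δ^tp_Ÿ)^Θ`, which
centralises `Δ_Θ`, classes are homomorphisms (`ContH1.pow_eq_one_of_res_eq_one`).
[cite: MochizukiEtTh2009, Prop 1.5 (ii) p.23] -/
theorem _root_.Literature.AnabelianGeometry.EtaleTheta.ThetaSetting.KummerData.logUdd_infiniteOrderOn_of_pow_mem
    (E : D.KummerData)
    (hL : ∀ n : ℤ, E.logUdd ^ n ∈ (Fdd2 : Subgroup (D.H1Theta (D.GtpYdd.map D.toTheta))) → n = 0)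
    {H' : Subgroup D.PiTemp} (hH' : H' ≤ D.GtpYdd) {m : ℕ} (hm : m ≠ 0)
    (hpow : ∀ g ∈ (D.DtpYddN 1).map D.toTheta, g ^ m ∈ (H' ⊓ D.DeltaTemp).map D.toTheta) (n : ℤ)
    (hn : ContH1.res (MonoidHom.id D.GtpTheta) D.DeltaTheta
        ((map_inf_deltaTemp_le_DtpYddTheta hH').trans
          (Subgroup.map_mono inf_le_left : (D.DtpYddN 1).map D.toTheta ≤ D.GtpYdd.map D.toTheta))
        (E.logUdd ^ n) = 1) : n = 0 := by
  have hcomm : ∀ g ∈ (D.DtpYddN 1).map D.toTheta, ∀ a : D.GtpTheta, a ∈ D.DeltaTheta →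
      MonoidHom.id D.GtpTheta g * a = a * MonoidHom.id D.GtpTheta g :=
    fun g hg a ha => deltaTheta_comm_of_mem_map_deltaTemp (inf_le_right : D.DtpYddN 1 ≤ D.DeltaTemp)
      g hg a ha
  -- the restriction of `log(Ü)^n` to `(Δ^tp_Ÿ)^Θ` has trivial restriction to `(H' ∩ Δ)^Θ`, hence is
  -- killed by `m`
  set z := ContH1.res (MonoidHom.id D.GtpTheta) D.DeltaTheta
    (Subgroup.map_mono inf_le_left : (D.DtpYddN 1).map D.toTheta ≤ D.GtpYdd.map D.toTheta)
    (E.logUdd ^ n) with hz_def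
  have hz : ContH1.res (MonoidHom.id D.GtpTheta) D.DeltaTheta (map_inf_deltaTemp_le_DtpYddTheta hH')
      z = 1 := by
    rw [hz_def, ContH1.res_res]
    exact hn
  have hzm : z ^ m = 1 :=
    ContH1.pow_eq_one_of_res_eq_one (map_inf_deltaTemp_le_DtpYddTheta hH') hcomm hpow z hz
  have hmem : E.logUdd ^ (n * m) ∈ (Fdd2 : Subgroup (D.H1Theta (D.GtpYdd.map D.toTheta))) := by
    change ContH1.res _ _ _ _ = 1
    rw [zpow_mul, zpow_natCast, map_pow, ← hz_def, hzm]
  have := hL _ hmem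
  rcases mul_eq_zero.mp this with h | h
  · exact h
  · exact absurd (by exact_mod_cast h) hm

/-- **Assembly for a subgroup of the shape `Π^tp_Ÿ̲̲`**: for `H' ≤ Π^tp_Ÿ` such that every `m`-th power
(`m ≠ 0`) of `(Δ^tp_Ÿ)^Θ` lies in `(H' ∩ Δ^tp_X)^Θ`, `γ ↦ a ≠ 0` in `Z`, `k ≠ 0`, and a theta class `x`,
the restriction to `H'` of `γᵏ · x · x⁻¹` is not a torsion class — given `Prop15ii`, `Prop15iii` and the
clause `hL` ("`F̈¹/F̈² = Ẑ · log(Ü)`"). [cite: MochizukiEtTh2009, Prop 1.5 (iii) p.23] -/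
theorem not_isOfFinOrder_res_conj_zpow_div (hC : D.Compat) (h15 : Prop15iii E hC)
    (h15ii : Prop15ii E.toKummerData hC)
    (hL : ∀ n : ℤ, E.logUdd ^ n ∈ (Fdd2 : Subgroup (D.H1Theta (D.GtpYdd.map D.toTheta))) → n = 0)
    {H' : Subgroup D.PiTemp} (hH' : H' ≤ D.GtpYdd) {m : ℕ} (hm : m ≠ 0)
    (hpow : ∀ g ∈ (D.DtpYddN 1).map D.toTheta, g ^ m ∈ (H' ⊓ D.DeltaTemp).map D.toTheta)
    {γ : D.PiTemp} (hγ : D.toZ γ ≠ 1) {k : ℤ} (hk : k ≠ 0) {x : D.H1 D.GtpYdd}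
    (hx : x ∈ E.thetaClasses) :
    haveI := hC.GtpYdd_normal
    ¬ IsOfFinOrder (ContH1.res D.toTheta D.DeltaTheta hH'
      (ContH1.conj D.toTheta D.DeltaTheta (γ ^ k) x * x⁻¹)) :=
  E.not_isOfFinOrder_res_conj_div hC h15 h15ii hH'
    (E.toKummerData.logUdd_infiniteOrderOn_of_pow_mem hL hH' hm hpow) (toZ_zpow_ne_one hγ hk) hx

/-- **Pulled-back form** (the shape consumed in §2, where `Π^tp_Ÿ̲̲ = Π_Ÿ(Π) ⊆ Π^tp_X̲̲ ↪ Π^tp_X` is a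
subgroup of the subtype group `Π^tp_X̲̲` and classes are pulled back with abc-iut-w4-d014's `ContH1.comap`
along the inclusion `ι`): under the same hypotheses, with `H₀ ≤ G₀` mapping into `Π^tp_Ÿ` and the power
condition for `ι(H₀)`, the pull-back to `H₀` of `γᵏ · x · x⁻¹` is not a torsion class.
[cite: MochizukiEtTh2009, Prop 1.5 (iii) p.23] -/
theorem not_isOfFinOrder_comap_conj_zpow_div (hC : D.Compat) (h15 : Prop15iii E hC)
    (h15ii : Prop15ii E.toKummerData hC)
    (hL : ∀ n : ℤ, E.logUdd ^ n ∈ (Fdd2 : Subgroup (D.H1Theta (D.GtpYdd.map D.toTheta))) → n = 0)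
    {G₀ : Type*} [Group G₀] [TopologicalSpace G₀] {ι : G₀ →* D.PiTemp} (hι : Continuous ι)
    {H₀ : Subgroup G₀} (hH₀ : H₀.map ι ≤ D.GtpYdd) {m : ℕ} (hm : m ≠ 0)
    (hpow : ∀ g ∈ (D.DtpYddN 1).map D.toTheta, g ^ m ∈ (H₀.map ι ⊓ D.DeltaTemp).map D.toTheta)
    {γ : D.PiTemp} (hγ : D.toZ γ ≠ 1) {k : ℤ} (hk : k ≠ 0) {x : D.H1 D.GtpYdd}
    (hx : x ∈ E.thetaClasses) :
    haveI := hC.GtpYdd_normal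
    ¬ IsOfFinOrder (ContH1.comap D.toTheta D.DeltaTheta ι hι hH₀
      (ContH1.conj D.toTheta D.DeltaTheta (γ ^ k) x * x⁻¹)) :=
  fun h => E.not_isOfFinOrder_res_conj_zpow_div hC h15 h15ii hL hH₀ hm hpow hγ hk hx
    (ContH1.isOfFinOrder_res_of_isOfFinOrder_comap hH₀ _ h)

/-- The same for a single `σ ∈ Π^tp_X` with nonzero image in `Z` (no power condition on `σ`).
[cite: MochizukiEtTh2009, Prop 1.5 (iii) p.23] -/
theorem not_isOfFinOrder_comap_conj_div (hC : D.Compat) (h15 : Prop15iii E hC)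
    (h15ii : Prop15ii E.toKummerData hC)
    (hL : ∀ n : ℤ, E.logUdd ^ n ∈ (Fdd2 : Subgroup (D.H1Theta (D.GtpYdd.map D.toTheta))) → n = 0)
    {G₀ : Type*} [Group G₀] [TopologicalSpace G₀] {ι : G₀ →* D.PiTemp} (hι : Continuous ι)
    {H₀ : Subgroup G₀} (hH₀ : H₀.map ι ≤ D.GtpYdd) {m : ℕ} (hm : m ≠ 0)
    (hpow : ∀ g ∈ (D.DtpYddN 1).map D.toTheta, g ^ m ∈ (H₀.map ι ⊓ D.DeltaTemp).map D.toTheta)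
    {σ : D.PiTemp} (hσ : D.toZ σ ≠ 1) {x : D.H1 D.GtpYdd} (hx : x ∈ E.thetaClasses) :
    haveI := hC.GtpYdd_normal
    ¬ IsOfFinOrder (ContH1.comap D.toTheta D.DeltaTheta ι hι hH₀
      (ContH1.conj D.toTheta D.DeltaTheta σ x * x⁻¹)) :=
  fun h => E.not_isOfFinOrder_res_conj_div hC h15 h15ii hH₀
    (E.toKummerData.logUdd_infiniteOrderOn_of_pow_mem hL hH₀ hm hpow) hσ hx
    (ContH1.isOfFinOrder_res_of_isOfFinOrder_comap hH₀ _ h)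

end EtaleThetaData

end ThetaSetting

end Literature.AnabelianGeometry.EtaleTheta

end
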